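import Literature.Computability.Complexity.HiraharaPreprocess
import HarnessLib

/-!
# Hirahara's reduction: the complete specification and its correctness on the promise

Topic `Computability/Complexity`. The full (mathematical) reduction of Hirahara's Thm. 8.5
(`MCSP*` case; ECCC TR22-119, p. 31, with Lemma 8.3) as a function
`HiraharaRed.redOut c I₀ r` of a threshold constant `c`, a CMMSA instance `I₀` and a coin string `r`:
degenerate instances are decided directly (ill-formed / an empty formula ⇒ a fixed no-instance `NO₀`;
total weight `≤ θ` or all reduced formulas identically true ⇒ a fixed yes-instance `YES₀`; `θ = 0`
⇒ `NO₀`), small instances (`Δ(n) < c`) by brute force, and the remaining ones by the main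
construction `(Pre.toPInst I₀).output` on the coins `coinsOf` read off `r`. Correctness on the
promise of `gapCMMSA (Δ^α) (Δ^{-α}) sqrtLog` (for `c ≥ 1` with `c^α ≥ 107520`):

* `HiraharaRed.redOut_mem_of_yes` — yes-instances are mapped into `MCSP*` for EVERY coin string;
* `HiraharaRed.card_redOut_mem_mul_three_le` — for no-instances, at most a third of the coin strings
  of any length `m ≥ totCoins` are mapped into `MCSP*`.

Also: the fixed instances `YES₀ ∈ MCSP*`, `NO₀ ∉ MCSP*`, the coin layout `coinsOf` and its uniform
fibres (`card_filter_coinsOf_eq`).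

## References

* S. Hirahara, *NP-hardness of learning programs and partial MCSP*, ECCC TR22-119, proof of
  Thm. 8.5 (`MCSP*` case) and of Lemma 8.3 [Hirahara2022PartialMCSP].
-/

namespace Literature.Computability.Complexity

open Finset
open _root_.Computability
open Literature.Computability.MetaComplexity (MonotoneDNF MCSPStar sqrtLog CMMSAInstance boolFunEquivFin)
open Literature.Computability.MetaComplexity.CMMSA (yesSet noSet)

namespace HiraharaRed

/-! ### Two fixed `MCSP*` instances -/

/-- A fixed yes-instance of `MCSP*`: the all-`*` table on `0` input bits with budget `1`.
[cite: Hirahara2022PartialMCSP, proof of Thm. 8.5 (trivial instances)] -/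
def YES₀ : List Bool :=
  boolPair ((encodingBoolBool.optionBool).listBool.encode (List.ofFn fun _ : Fin (2 ^ 0) => (none : Option Bool)))
    (encodeNat 1)

/-- A fixed no-instance of `MCSP*`: a defined table on `0` input bits with budget `0` (there is no
circuit with `0` gates and no inputs). [cite: Hirahara2022PartialMCSP, proof of Thm. 8.5 (trivial instances)] -/
def NO₀ : List Bool :=
  boolPair ((encodingBoolBool.optionBool).listBool.encode (List.ofFn fun _ : Fin (2 ^ 0) => some true))
    (encodeNat 0)

/-- `YES₀ ∈ MCSP*`. [folklore] -/
theorem YES₀_mem : YES₀ ∈ MCSPStar := by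
  obtain ⟨C, hC, hs, -⟩ := (cktSize_const (Fin 0) true).toCircuit
  exact ⟨0, _, 1, rfl, C, hC, hs, fun i b h => by simp at h⟩

/-- `NO₀ ∉ MCSP*`. [folklore] -/
theorem NO₀_not_mem : NO₀ ∉ MCSPStar := by
  rintro ⟨m, T, s', hw, C, -, hsize, -⟩
  have h := congrArg boolUnpair hw
  simp only [NO₀, boolUnpair_boolPair, Prod.mk.injEq] at h
  obtain ⟨hfT, hs⟩ := h
  have hs' : 0 = s' := by
    have := congrArg decodeNat hs
    rwa [_root_.Computability.decode_encodeNat, _root_.Computability.decode_encodeNat] at this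
  subst hs'
  have hl := (encodingBoolBool.optionBool).listBool.encode_injective hfT
  have hlen := congrArg List.length hl
  simp only [List.length_ofFn] at hlen
  obtain rfl : 0 = m := Nat.pow_right_injective le_rfl hlen
  -- a circuit with no gates on no inputs has no output wire
  have hg : C.gates = [] := List.eq_nil_of_length_eq_zero (Nat.le_zero.1 hsize)
  rcases hC : C.output with i | k
  · exact i.elim0
  · have := C.wf_output k hC
    rw [hg] at this
    simp at this

/-! ### The coin layout -/

namespace PInst

variable (I : PInst)

/-- The number of coins: one truth table of `2^{N_k}` bits per variable. [cite: Hirahara2022PartialMCSP, proof of Lemma 8.3 ("pick fᵢ ∼ {0,1}^{λw(i)}")] -/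
def totCoins : ℕ := ∑ k : Fin I.n, 2 ^ I.N k

/-- The offset of the truth table of variable `k` in the coin string. [folklore] -/
def off (k : Fin I.n) : ℕ := ∑ k' ∈ univ.filter (fun k' : Fin I.n => k' < k), 2 ^ I.N k'

/-- The coin index type: (variable, input). [folklore] -/
abbrev CoinIdx : Type := Σ k : Fin I.n, (Fin (I.N k) → Bool)

/-- The position of a coin. [folklore] -/
def pos (kv : CoinIdx I) : ℕ := I.off kv.1 + (boolFunEquivFin (I.N kv.1) kv.2).val

/-- **The coins read off a coin string**: `f_k(v) = r[off k + #v]`. [cite: Hirahara2022PartialMCSP, proof of Lemma 8.3] -/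
def coinsOf (r : List Bool) : Coins I.A := fun k v => r.getD (I.pos ⟨k, v⟩) false

/-- `off k + 2^{N_k} ≤ off k'` for `k < k'`. [folklore] -/
theorem off_add_le_off {k k' : Fin I.n} (h : k < k') : I.off k + 2 ^ I.N k ≤ I.off k' := by
  unfold off
  have hsub : univ.filter (fun j : Fin I.n => j < k) ∪ {k} ⊆ univ.filter (fun j : Fin I.n => j < k') := by
    intro j hj
    rw [mem_union, mem_filter, mem_singleton] at hj
    rw [mem_filter]
    rcases hj with ⟨-, hj⟩ | rfl
    · exact ⟨mem_univ _, hj.trans h⟩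
    · exact ⟨mem_univ _, h⟩
  have hdisj : Disjoint (univ.filter fun j : Fin I.n => j < k) {k} := by
    rw [disjoint_singleton_right, mem_filter]; exact fun h => lt_irrefl _ h.2
  calc _ = ∑ j ∈ univ.filter (fun j : Fin I.n => j < k) ∪ {k}, 2 ^ I.N j := by rw [sum_union hdisj, sum_singleton]
    _ ≤ _ := sum_le_sum_of_subset_of_nonneg hsub fun _ _ _ => Nat.zero_le _

/-- `off k + 2^{N_k} ≤ totCoins`. [folklore] -/
theorem off_add_le_totCoins (k : Fin I.n) : I.off k + 2 ^ I.N k ≤ I.totCoins := by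
  unfold off totCoins
  have hdisj : Disjoint (univ.filter fun j : Fin I.n => j < k) {k} := by
    rw [disjoint_singleton_right, mem_filter]; exact fun h => lt_irrefl _ h.2
  calc _ = ∑ j ∈ univ.filter (fun j : Fin I.n => j < k) ∪ {k}, 2 ^ I.N j := by rw [sum_union hdisj, sum_singleton]
    _ ≤ _ := sum_le_sum_of_subset_of_nonneg (subset_univ _) fun _ _ _ => Nat.zero_le _

/-- Positions are `< totCoins`. [folklore] -/
theorem pos_lt (kv : CoinIdx I) : I.pos kv < I.totCoins := by
  unfold pos
  have := (boolFunEquivFin (I.N kv.1) kv.2).isLt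
  have := I.off_add_le_totCoins kv.1
  omega

/-- Positions are distinct. [folklore] -/
theorem pos_injective : Function.Injective I.pos := by
  rintro ⟨k, v⟩ ⟨k', v'⟩ h
  unfold pos at h
  simp only at h
  rcases lt_trichotomy k k' with hlt | rfl | hgt
  · have := I.off_add_le_off hlt
    have := (boolFunEquivFin (I.N k) v).isLt
    omega
  · have hv : boolFunEquivFin (I.N k) v = boolFunEquivFin (I.N k) v' := Fin.ext (by omega)
    rw [(boolFunEquivFin (I.N k)).injective hv]
  · have := I.off_add_le_off hgt
    have := (boolFunEquivFin (I.N k') v').isLt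
    omega

/-- `|Coins| = 2^{totCoins}`. [folklore] -/
theorem card_coins : Fintype.card (Coins I.A) = 2 ^ I.totCoins := by
  unfold totCoins
  rw [Fintype.card_pi, ← Finset.prod_pow_eq_pow_sum]
  refine Finset.prod_congr rfl fun k _ => ?_
  rw [Fintype.card_fun, Fintype.card_bool, Fintype.card_fun, Fintype.card_bool, Fintype.card_fin]
  rfl

/-- The number of coin indices is `totCoins`. [folklore] -/
theorem card_coinIdx : Fintype.card (CoinIdx I) = I.totCoins := by
  unfold totCoins
  rw [Fintype.card_sigma]
  refine Finset.sum_congr rfl fun k _ => ?_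
  rw [Fintype.card_fun, Fintype.card_bool, Fintype.card_fin]

/-- The positions inside a coin vector of length `m ≥ totCoins`. [folklore] -/
def posFin {m : ℕ} (hm : I.totCoins ≤ m) (kv : CoinIdx I) : Fin m := ⟨I.pos kv, (I.pos_lt kv).trans_le hm⟩

/-- `posFin` is injective. [folklore] -/
theorem posFin_injective {m : ℕ} (hm : I.totCoins ≤ m) : Function.Injective (I.posFin hm) :=
  fun _ _ h => I.pos_injective (congrArg Fin.val h)

/-- Reading the coins off a vector through `posFin`. [folklore] -/
theorem coinsOf_toList {m : ℕ} (hm : I.totCoins ≤ m) (r : List.Vector Bool m) (k : Fin I.n) (v : Fin (I.N k) → Bool) :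
    I.coinsOf r.toList k v = r.get (I.posFin hm ⟨k, v⟩) := by
  have hlt : I.pos ⟨k, v⟩ < r.toList.length := by
    rw [List.Vector.toList_length]; exact (I.pos_lt _).trans_le hm
  unfold coinsOf
  rw [List.getD_eq_getElem _ _ hlt, List.Vector.get_eq_get_toList]
  rfl

/-- Inverting `posFin` on its range. [folklore] -/
theorem ofInjective_posFin_symm {m : ℕ} (hm : I.totCoins ≤ m) (kv : CoinIdx I)
    (h : I.posFin hm kv ∈ Set.range (I.posFin hm)) :
    (Equiv.ofInjective _ (I.posFin_injective hm)).symm ⟨I.posFin hm kv, h⟩ = kv := by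
  apply I.posFin_injective hm
  have := Equiv.apply_ofInjective_symm (I.posFin_injective hm) ⟨I.posFin hm kv, h⟩
  simpa only using this

/-- **Uniform fibres of the coin layout**: for `m ≥ totCoins`, every coin outcome `F` is read off
exactly `2^{m - totCoins}` coin vectors. [folklore] -/
theorem card_filter_coinsOf_eq {m : ℕ} (hm : I.totCoins ≤ m) (F : Coins I.A) :
    ((univ : Finset (List.Vector Bool m)).filter fun r => I.coinsOf r.toList = F).card = 2 ^ (m - I.totCoins) := by
  classical
  -- the fibre, as a subtype, is in bijection with the assignments of the free positions
  have hfibre : ((univ : Finset (List.Vector Bool m)).filter fun r => I.coinsOf r.toList = F).card =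
      Fintype.card ({i : Fin m // i ∉ Set.range (I.posFin hm)} → Bool) := by
    rw [← Fintype.card_coe]
    refine Fintype.card_congr ?_
    refine
      { toFun := fun r i => r.1.get i.1
        invFun := fun c => ⟨List.Vector.ofFn fun i =>
            if h : i ∈ Set.range (I.posFin hm) then
              F ((Equiv.ofInjective _ (I.posFin_injective hm)).symm ⟨i, h⟩).1
                ((Equiv.ofInjective _ (I.posFin_injective hm)).symm ⟨i, h⟩).2
            else c ⟨i, h⟩, ?_⟩
        left_inv := ?_
        right_inv := ?_ }
    · rw [mem_filter]
      refine ⟨mem_univ _, ?_⟩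
      funext k v
      rw [I.coinsOf_toList hm, List.Vector.get_ofFn]
      have hmem : I.posFin hm ⟨k, v⟩ ∈ Set.range (I.posFin hm) := ⟨_, rfl⟩
      rw [dif_pos hmem, I.ofInjective_posFin_symm hm ⟨k, v⟩ hmem]
    · rintro ⟨r, hr⟩
      apply Subtype.ext
      simp only
      apply List.Vector.ext
      intro i
      rw [List.Vector.get_ofFn]
      split_ifs with h
      · obtain ⟨⟨k, v⟩, rfl⟩ := h
        rw [I.ofInjective_posFin_symm hm ⟨k, v⟩]
        have hF := (mem_filter.1 hr).2
        rw [← hF, I.coinsOf_toList hm]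
      · rfl
    · intro c
      funext i
      simp only [List.Vector.get_ofFn]
      rw [dif_neg i.2]
  rw [hfibre, Fintype.card_fun, Fintype.card_bool]
  congr 1
  -- the free positions number `m - totCoins`
  rw [Fintype.card_subtype_compl, Fintype.card_fin]
  congr 1
  convert (Set.card_range_of_injective (I.posFin_injective hm)).trans I.card_coinIdx using 2

/-- **Counting through the coin layout**: the number of coin vectors whose coins satisfy `P` is
`2^{m - totCoins}` times the number of coin outcomes satisfying `P`. [folklore] -/
theorem card_filter_vector_eq {m : ℕ} (hm : I.totCoins ≤ m) (P : Coins I.A → Prop) [DecidablePred P] :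
    ((univ : Finset (List.Vector Bool m)).filter fun r => P (I.coinsOf r.toList)).card =
      2 ^ (m - I.totCoins) * ((univ : Finset (Coins I.A)).filter P).card := by
  classical
  rw [card_eq_sum_card_fiberwise (f := fun r : List.Vector Bool m => I.coinsOf r.toList)
    (t := (univ : Finset (Coins I.A)).filter P) (fun r hr => by
      rw [Finset.mem_coe, mem_filter] at hr ⊢; exact ⟨mem_univ _, hr.2⟩)]
  calc ∑ F ∈ (univ : Finset (Coins I.A)).filter P,
        (((univ : Finset (List.Vector Bool m)).filter fun r => P (I.coinsOf r.toList)).filter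
          fun r => I.coinsOf r.toList = F).card
      = ∑ F ∈ (univ : Finset (Coins I.A)).filter P, 2 ^ (m - I.totCoins) := by
        refine sum_congr rfl fun F hF => ?_
        have hP : P F := (mem_filter.1 hF).2
        rw [Finset.filter_filter]
        have : ((univ : Finset (List.Vector Bool m)).filter fun r => P (I.coinsOf r.toList) ∧ I.coinsOf r.toList = F) =
            (univ : Finset (List.Vector Bool m)).filter fun r => I.coinsOf r.toList = F := by
          refine filter_congr fun r _ => ⟨fun h => h.2, fun h => ⟨h ▸ hP, h⟩⟩
        rw [this, I.card_filter_coinsOf_eq hm F]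
    _ = _ := by rw [sum_const, smul_eq_mul, mul_comm]

end PInst

/-! ### The complete reduction -/

section Red

open scoped Classical

variable (c : ℕ) (I₀ : CMMSAInstance)

/-- Brute force (a Boolean): is there a set of variables of weight `≤ θ` satisfying every formula?
[cite: Hirahara2022PartialMCSP, proof of Thm. 8.5 (instances of bounded size)] -/
def bruteYes : Bool :=
  decide (∃ S ∈ (Finset.range I₀.numVars).powerset, ∑ i ∈ S, I₀.w i ≤ I₀.threshold ∧
    ∀ φ ∈ I₀.formulas, φ.eval (fun v => decide (v ∈ S)) = true)

/-- **The reduction** (threshold constant `c`): degenerate instances decided directly, small ones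
(`Δ(n) < c`) by brute force, the rest by the main construction on the coins read off `r`.
[cite: Hirahara2022PartialMCSP, proof of Thm. 8.5 (MCSP* case) with Lemma 8.3] -/
noncomputable def redOut (r : List Bool) : List Bool :=
  open scoped Classical in
  if ¬I₀.WellFormed then NO₀
  else if [] ∈ I₀.formulas then NO₀
  else if sqrtLog I₀.numVars < I₀.degree then NO₀
  else if Pre.totalW I₀ ≤ I₀.threshold then YES₀
  else if Pre.kept I₀ = [] then YES₀
  else if I₀.threshold = 0 then NO₀
  else if sqrtLog I₀.numVars < c then (if bruteYes I₀ then YES₀ else NO₀)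
  else (Pre.toPInst I₀).output ((Pre.toPInst I₀).coinsOf r)

variable {c I₀}

/-- The empty formula is never satisfied. [folklore] -/
theorem nil_notMem_of_sat {a : ℕ → Bool} (hsat : ∀ φ ∈ I₀.formulas, φ.eval a = true) : [] ∉ I₀.formulas :=
  fun h => by have := hsat [] h; simp [MonotoneDNF.eval] at this

/-- Evaluating a formula over `[n]` at a set of variables `< n`. [folklore] -/
theorem eval_filter_range {n : ℕ} {φ : MonotoneDNF} (hφ : φ.IsOver n) (a : ℕ → Bool) :
    φ.eval (fun v => decide (v ∈ (Finset.range n).filter fun i => a i = true)) = φ.eval a := by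
  rw [Bool.eq_iff_iff, MonotoneDNF.eval_eq_true_iff, MonotoneDNF.eval_eq_true_iff]
  constructor
  · rintro ⟨t, ht, h⟩
    exact ⟨t, ht, fun i hi => by have := h i hi; simp at this; exact this.2⟩
  · rintro ⟨t, ht, h⟩
    exact ⟨t, ht, fun i hi => by simp [hφ t ht i hi, h i hi]⟩

/-- **Completeness of the reduction**: for `c ≥ 1`, yes-instances are mapped into `MCSP*` for every
coin string. [cite: Hirahara2022PartialMCSP, proof of Thm. 8.5 (MCSP* case: "Yes instances … are reduced to Yes instances of MCSP*")] -/
theorem redOut_mem_of_yes (hc : 1 ≤ c) (hy : I₀ ∈ yesSet sqrtLog) (r : List Bool) : redOut c I₀ r ∈ MCSPStar := by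
  classical
  obtain ⟨hwf, hdeg, a, hθ, hsat⟩ := hy
  have hne : [] ∉ I₀.formulas := nil_notMem_of_sat hsat
  unfold redOut
  rw [if_neg (not_not.2 hwf), if_neg hne, if_neg (not_lt.2 hdeg)]
  by_cases hW : Pre.totalW I₀ ≤ I₀.threshold
  · rw [if_pos hW]; exact YES₀_mem
  rw [if_neg hW]
  by_cases hk : Pre.kept I₀ = []
  · rw [if_pos hk]; exact YES₀_mem
  rw [if_neg hk]
  -- `θ ≠ 0`: a kept formula forces a positive-weight true variable
  have hθ0 : I₀.threshold ≠ 0 := by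
    intro h0
    obtain ⟨ψ, hψ⟩ := List.exists_mem_of_ne_nil _ hk
    obtain ⟨⟨φ, hφ, rfl⟩, hnil⟩ := Pre.mem_kept_iff.1 hψ
    obtain ⟨t, ht, hta⟩ := (MonotoneDNF.eval_eq_true_iff _ _).1 (hsat φ hφ)
    -- every true variable has weight `0`
    have hzero : ∀ i ∈ t, I₀.w i = 0 := by
      intro i hi
      have hin : i < I₀.numVars := hwf.2 φ hφ t ht i hi
      have hle : (if a i then I₀.w i else 0) ≤ I₀.weightOf a :=
        Finset.single_le_sum (f := fun i => if a i then I₀.w i else 0) (fun _ _ => Nat.zero_le _) (Finset.mem_range.2 hin)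
      rw [hta i hi, if_pos rfl] at hle
      omega
    apply hnil
    unfold Pre.redFormula
    refine List.mem_map.2 ⟨t, ht, ?_⟩
    rw [List.filter_eq_nil_iff]
    intro i hi
    simpa using hzero i hi
  rw [if_neg hθ0]
  by_cases hsmall : sqrtLog I₀.numVars < c
  · rw [if_pos hsmall, if_pos]
    · exact YES₀_mem
    · unfold bruteYes
      rw [decide_eq_true_iff]
      refine ⟨(Finset.range I₀.numVars).filter fun i => a i = true, Finset.mem_powerset.2 (Finset.filter_subset _ _), ?_, ?_⟩
      · refine le_trans (le_of_eq ?_) hθ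
        unfold CMMSAInstance.weightOf
        rw [Finset.sum_filter]
      · intro φ hφ
        rw [eval_filter_range (hwf.2 φ hφ)]
        exact hsat φ hφ
  rw [if_neg hsmall]
  -- the main construction
  have h2 : 2 ≤ I₀.numVars := by
    have h1 : 1 ≤ sqrtLog I₀.numVars := le_trans hc (not_lt.1 hsmall)
    by_contra hlt
    have : sqrtLog I₀.numVars = 0 := by
      unfold MetaComplexity.sqrtLog
      interval_cases I₀.numVars <;> simp
    omega
  have hB := Pre.toPInst_big h2 hwf hdeg hne (not_le.1 hW)
  obtain ⟨T, hTw, hTθ, hauth⟩ := Pre.exists_witness_of_assignment hwf hθ hsat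
  exact hB.output_mem_of_witness T hTw hTθ hauth _

/-- **Soundness of the reduction**: for `c ≥ 1` with `c^α ≥ 107520`, for a no-instance of
`gapCMMSA (Δ^α) (Δ^{-α})`, at most a third of the coin strings of any length `m ≥ totCoins` are
mapped into `MCSP*`. [cite: Hirahara2022PartialMCSP, proof of Thm. 8.5 (MCSP* case: "No instances … are reduced to No instances … with probability at least 1 − o(1)")] -/
theorem card_redOut_mem_mul_three_le {α : ℝ} (hα : 0 < α) (hc : 1 ≤ c) (hcα : (107520 : ℝ) ≤ (c : ℝ) ^ α)
    (hno : I₀ ∈ noSet (fun n => (sqrtLog n : ℝ) ^ α) (fun n => (sqrtLog n : ℝ) ^ (-α)) sqrtLog)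
    {m : ℕ} (hm : (Pre.toPInst I₀).totCoins ≤ m) :
    ((univ : Finset (List.Vector Bool m)).filter fun r : List.Vector Bool m => redOut c I₀ r.toList ∈ MCSPStar).card * 3 ≤ 2 ^ m := by
  classical
  obtain ⟨hwf, hdeg, hnoa⟩ := hno
  -- consequences of the no-promise
  have hsatlt : ∀ a : ℕ → Bool, I₀.weightOf a ≤ I₀.threshold → ¬∀ φ ∈ I₀.formulas, φ.eval a = true := by
    intro a ha hall
    set Δn := sqrtLog I₀.numVars with hΔn
    have hsc : I₀.satCount a = I₀.numFormulas := by
      unfold CMMSAInstance.satCount CMMSAInstance.numFormulas; rw [List.countP_eq_length]; exact hall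
    rcases Nat.eq_zero_or_pos Δn with h0 | hpos
    · -- `Δ = 0`: `g = ε = 0`, the all-false assignment refutes the no-condition
      have h := hnoa (fun _ => false) (by
        simp only [← hΔn, h0, Nat.cast_zero, Real.zero_rpow hα.ne']
        simp [CMMSAInstance.weightOf])
      simp only [← hΔn, h0, Nat.cast_zero, Real.zero_rpow (neg_ne_zero.2 hα.ne'), zero_mul] at h
      exact absurd h (by exact_mod_cast Nat.not_lt_zero _)
    · have hg1 : (1 : ℝ) ≤ (Δn : ℝ) ^ α := Real.one_le_rpow (by exact_mod_cast hpos) hα.le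
      have hε1 : (Δn : ℝ) ^ (-α) ≤ 1 := Real.rpow_le_one_of_one_le_of_nonpos (by exact_mod_cast hpos) (by linarith)
      have h := hnoa a (by
        calc (I₀.weightOf a : ℝ) ≤ I₀.threshold := by exact_mod_cast ha
          _ = 1 * I₀.threshold := (one_mul _).symm
          _ ≤ (Δn : ℝ) ^ α * I₀.threshold := by gcongr)
      rw [hsc] at h
      have : (I₀.numFormulas : ℝ) < I₀.numFormulas := by
        calc (I₀.numFormulas : ℝ) < (Δn : ℝ) ^ (-α) * I₀.numFormulas := h
          _ ≤ 1 * I₀.numFormulas := by gcongr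
          _ = _ := one_mul _
      exact lt_irrefl _ this
  have hcount0 : ∀ {P : List.Vector Bool m → Prop} [DecidablePred P], (∀ r, ¬P r) →
      ((univ : Finset (List.Vector Bool m)).filter P).card * 3 ≤ 2 ^ m := by
    intro P _ h
    rw [Finset.filter_false_of_mem fun r _ => h r]; simp
  -- rewriting the counted predicate through a pointwise description of `redOut`
  have hrw : ∀ {g : List Bool → List Bool}, (∀ r, redOut c I₀ r = g r) →
      ((univ : Finset (List.Vector Bool m)).filter fun r : List.Vector Bool m => redOut c I₀ r.toList ∈ MCSPStar) =
        (univ : Finset (List.Vector Bool m)).filter fun r : List.Vector Bool m => g r.toList ∈ MCSPStar := by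
    intro g hg
    exact filter_congr fun r _ => by rw [hg]
  have hlen : ¬¬I₀.WellFormed := not_not.2 hwf
  have hdg : ¬(sqrtLog I₀.numVars < I₀.degree) := not_lt.2 hdeg
  by_cases hnil : [] ∈ I₀.formulas
  · rw [hrw (g := fun _ => NO₀) fun r => by unfold redOut; rw [if_neg hlen, if_pos hnil]]
    exact hcount0 fun _ => NO₀_not_mem
  by_cases hW : Pre.totalW I₀ ≤ I₀.threshold
  · -- impossible: the all-true assignment is light and satisfies everything
    exfalso
    refine hsatlt (fun _ => true) ?_ fun φ hφ => ?_
    · unfold CMMSAInstance.weightOf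
      simp only [if_true]
      exact hW
    · rw [MonotoneDNF.eval_eq_true_iff]
      obtain ⟨t, ht⟩ := List.exists_mem_of_ne_nil φ (fun h => hnil (h ▸ hφ))
      exact ⟨t, ht, fun _ _ => rfl⟩
  by_cases hk : Pre.kept I₀ = []
  · -- impossible: the zero-weight assignment is light and satisfies everything
    exfalso
    have hall := Pre.eval_indicator_of_authorized (I₀ := I₀) (∅ : Finset (Fin I₀.numVars))
      (fun j => absurd j.isLt (by change ¬(j.val < (Pre.kept I₀).length); rw [hk]; simp))
    refine hsatlt _ ?_ hall
    rw [Pre.weightOf_indicator]; simp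
  by_cases hθ0 : I₀.threshold = 0
  · rw [hrw (g := fun _ => NO₀) fun r => by unfold redOut; rw [if_neg hlen, if_neg hnil, if_neg hdg, if_neg hW, if_neg hk, if_pos hθ0]]
    exact hcount0 fun _ => NO₀_not_mem
  by_cases hsmall : sqrtLog I₀.numVars < c
  · have hb : ¬(bruteYes I₀ = true) := by
      unfold bruteYes
      rw [decide_eq_true_iff]
      rintro ⟨S, hS, hSw, hSsat⟩
      refine hsatlt (fun v => decide (v ∈ S)) ?_ hSsat
      unfold CMMSAInstance.weightOf
      have hsub : S ⊆ Finset.range I₀.numVars := Finset.mem_powerset.1 hS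
      calc ∑ i ∈ Finset.range I₀.numVars, (if decide (i ∈ S) = true then I₀.w i else 0)
          = ∑ i ∈ S, I₀.w i := by
            rw [← Finset.sum_filter]
            congr 1
            ext i; simp only [mem_filter, Finset.mem_range, decide_eq_true_eq]
            exact ⟨fun h => h.2, fun h => ⟨Finset.mem_range.1 (hsub h), h⟩⟩
        _ ≤ I₀.threshold := hSw
    rw [hrw (g := fun _ => NO₀) fun r => by
      unfold redOut; rw [if_neg hlen, if_neg hnil, if_neg hdg, if_neg hW, if_neg hk, if_neg hθ0, if_pos hsmall, if_neg hb]]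
    exact hcount0 fun _ => NO₀_not_mem
  -- the main construction
  rw [hrw (g := fun r => (Pre.toPInst I₀).output ((Pre.toPInst I₀).coinsOf r)) fun r => by
    unfold redOut; rw [if_neg hlen, if_neg hnil, if_neg hdg, if_neg hW, if_neg hk, if_neg hθ0, if_neg hsmall]]
  have hcle : c ≤ sqrtLog I₀.numVars := not_lt.1 hsmall
  have h2 : 2 ≤ I₀.numVars := by
    have h1 : 1 ≤ sqrtLog I₀.numVars := le_trans hc hcle
    by_contra hlt
    have : sqrtLog I₀.numVars = 0 := by
      unfold MetaComplexity.sqrtLog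
      interval_cases I₀.numVars <;> simp
    omega
  have hB := Pre.toPInst_big h2 hwf hdeg hnil (not_le.1 hW)
  set W₀ := ⌊(sqrtLog I₀.numVars : ℝ) ^ α * I₀.threshold⌋₊ with hW₀
  have hpos : 0 < sqrtLog I₀.numVars := lt_of_lt_of_le (by omega) hcle
  have hg0 : (0 : ℝ) ≤ (sqrtLog I₀.numVars : ℝ) ^ α := Real.rpow_nonneg (Nat.cast_nonneg _) _
  have hε1 : (sqrtLog I₀.numVars : ℝ) ^ (-α) ≤ 1 :=
    Real.rpow_le_one_of_one_le_of_nonpos (by exact_mod_cast hpos) (by linarith)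
  have hν : 0 < (Pre.toPInst I₀).ν := by
    change 0 < (Pre.kept I₀).length; exact List.length_pos_of_ne_nil hk
  have hNo := Pre.heavy_of_no (g := fun n => (sqrtLog n : ℝ) ^ α) (ε := fun n => (sqrtLog n : ℝ) ^ (-α))
    ⟨hwf, hdeg, hnoa⟩ hε1 hg0 hν
  have hW' : 107520 * (Pre.toPInst I₀).θ ≤ W₀ := by
    change 107520 * I₀.threshold ≤ W₀
    rw [hW₀]
    refine Nat.le_floor ?_
    push_cast
    have hcg : (c : ℝ) ^ α ≤ (sqrtLog I₀.numVars : ℝ) ^ α :=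
      Real.rpow_le_rpow (Nat.cast_nonneg _) (by exact_mod_cast hcle) hα.le
    have hθnn : (0 : ℝ) ≤ I₀.threshold := Nat.cast_nonneg _
    nlinarith
  have hmain := hB.card_output_mem_mul_three_le W₀ hW' hNo
  rw [PInst.card_coins] at hmain
  rw [(Pre.toPInst I₀).card_filter_vector_eq hm (fun F => (Pre.toPInst I₀).output F ∈ MCSPStar)]
  calc 2 ^ (m - (Pre.toPInst I₀).totCoins) *
        ((univ : Finset (Coins (Pre.toPInst I₀).A)).filter fun F => (Pre.toPInst I₀).output F ∈ MCSPStar).card * 3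
      = 2 ^ (m - (Pre.toPInst I₀).totCoins) *
          (((univ : Finset (Coins (Pre.toPInst I₀).A)).filter fun F => (Pre.toPInst I₀).output F ∈ MCSPStar).card * 3) := by ring
    _ ≤ 2 ^ (m - (Pre.toPInst I₀).totCoins) * 2 ^ (Pre.toPInst I₀).totCoins := Nat.mul_le_mul_left _ hmain
    _ = 2 ^ m := by rw [← pow_add, Nat.sub_add_cancel hm]

end Red

end HiraharaRed

end Literature.Computability.Complexity
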